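import Summits.Ventures.LatticeQCDFlow.Scaling.ProductRefreshAugmentation
import Summits.Ventures.LatticeQCDFlow.Scaling.IdealStarFreshness
import Summits.Ventures.LatticeQCDFlow.Scaling.TouchChainCover
import Summits.Ventures.LatticeQCDFlow.Scaling.ProductChainCollectorLaw

/-!
HONEST FRAMING: exact (Metropolis-corrected) sampling algorithms for lattice gauge theory; figures
of merit are autocorrelation/cost numbers at stated couplings and volumes; no continuum-physics
claim.

# ProductRefreshCeiling — THE COUPON-COLLECTOR LAW IS ATTAINED BY INDEPENDENT REDRAWS: THE RANDOM-SCAN EXACT REFRESH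
# ON `d` COORDINATES HAS `‖δ_x Pⁿ − π̃‖_TV ≤ Σ_k (1 − w_k)ⁿ ≤ d·e^{−n·w_min}`, SO `t_mix(ε) ≤ ⌈log(d/ε)/w_min⌉`; WITH
# THE FLOOR OF `Scaling/ProductChainCollectorLaw`: `(d − 1)·log(d/4) ≤ t_mix(1/4) ≤ ⌈log(4d)/w_min⌉` — ORDER `d·log d`
# FROM BOTH SIDES FOR UNIFORM WEIGHTS (lean-2 GEN-24, ours)

Venture-side (OURS).  Cell `lqcd-flow` (pub-lqcd), unit `pub-lqcd-lean-2-g24`, 2026-08-27.  Chapter L (the coupon-collector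
law from a cold start), file 19.  The product chain `prodKernel w M` on `Fin d → S` with EXACT coordinate samplers
`M_k(u,v) = μ_k(v)` and its stale-set augmentation `P̂` (`Scaling/ProductRefreshAugmentation`).  As for the idealised
star (`Scaling/IdealStarFreshness`), the law `ν̂_n = δ_{(x,univ)}P̂ⁿ` is FRESH-EXCHANGEABLE at every clean coordinate,
hence `δ_x Pⁿ ≥ (δ_{univ}Rⁿ)(∅)·π̃` with `R` the touch chain `Σ_k w_k𝟙{V = U∖{k}}`, whose uncovered mass is bounded by
`Scaling/TouchChainCover`.

## What is proved

* §1 `tensorFun_update_mul`; **`refresh_fresh_step`**, **`refresh_fresh_lawAt`** (fresh-exchangeability: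
  `ν̂_n(z[j ↦ v], D)·μ_j(z_j) = ν̂_n(z, D)·μ_j(v)` for `j ∉ D`); `fresh_empty_proportional_prod`,
  **`refresh_lawAt_empty_eq`** (`ν̂_n(z,∅) = (δ_{univ}Rⁿ)(∅)·π̃(z)`).
* §2 **`refresh_minorization`**, **`refresh_tvDist_le_uncovered`** (`‖δ_x Pⁿ − π̃‖_TV ≤ (δ_{univ}Rⁿ){V ≠ ∅}`),
  **`refresh_worstTvDist_le`** (`d(n) ≤ Σ_k (1 − w_k)ⁿ`), `refresh_worstTvDist_le_exp` (`≤ d·e^{−n·w_min}`),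
  **`refresh_mixingTime_le` (THE CEILING)** — `t_mix(ε) ≤ ⌈(log d + log(1/ε))/w_min⌉`.
* §3 **`refresh_mixingTime_two_sided` (THE `d·log d` LAW FOR EXACT REDRAWS, BOTH SIDES)** — `d ≥ 2`, a start with
  `Σ_k μ_k(x_k) ≤ 1/4`: **`(d − 1)·log(d/4) ≤ t_mix(1/4) ≤ ⌈(log d + log 4)/w_min⌉`**;
  `refresh_mixingTime_two_sided_of_card` (`|S| ≥ 4d` supplies the start).

Reading (no numerics implied): a sampler that redraws one coordinate at a time exactly from its marginal — the best a
single-site update can do — equilibrates at the coupon-collector time of its site-selection law, and no sooner from a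
rare start: `Θ(d·log d)` for uniform selection.  Against `Scaling/SingleSiteCollectorLaw`: every local rule needs
`(d−1)·log(d/4)`; exact redraws achieve `⌈d·log(4d)⌉`.  NOT CLAIMED: inexact local rules (heat bath of an interacting
system is exact for the CONDITIONAL law, not the marginal — the stale-set coupling then fails); small alphabets.
Literature grade (cell rule): OWN CONSTRUCTION on KNOWN MECHANISM (coupon-collector coupling for product chains);
nothing cited as a fact; no new bib keys.
-/

noncomputable section

open Finset Function
open Literature.Probability.MarkovChains

namespace Summit.Ventures.LatticeQCDFlow.Scaling

variable {S : Type*} [Fintype S] [DecidableEq S] {d : ℕ} {μ : Fin d → S → ℝ} {M : Fin d → S → S → ℝ} {w : Fin d → ℝ}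

/-! ## §1 Fresh-exchangeability -/

omit [Fintype S] [DecidableEq S] in
/-- `π̃(x[j ↦ v])·μ_j(x_j) = π̃(x)·μ_j(v)`. [ours] -/
theorem tensorFun_update_mul (μ : Fin d → S → ℝ) (x : Fin d → S) (j : Fin d) (v : S) :
    tensorFun μ (update x j v) * μ j (x j) = tensorFun μ x * μ j v := by
  rw [tensorFun_update μ x j v, tensorFun_eq_mul_prod μ x j]
  ring

/-- **FRESH-EXCHANGEABILITY IS PRESERVED BY ONE STEP** of the augmented refresh chain (`M_k(u,v) = μ_k(v)`). [ours] -/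
theorem refresh_fresh_step (hMex : ∀ k u v, M k u v = μ k v)
    {Ph : (Fin d → S) × Finset (Fin d) → (Fin d → S) × Finset (Fin d) → ℝ}
    (hPh : ∀ p q, Ph p q = ∑ k : Fin d, w k * (coordKernel M k p.1 q.1 * (if q.2 = p.2 \ {k} then (1 : ℝ) else 0)))
    {lam : (Fin d → S) × Finset (Fin d) → ℝ}
    (hlam : ∀ (z : Fin d → S) (D : Finset (Fin d)) (j : Fin d) (v : S), j ∉ D →
      lam (update z j v, D) * μ j (z j) = lam (z, D) * μ j v) :
    ∀ (z : Fin d → S) (D : Finset (Fin d)) (j : Fin d) (v : S), j ∉ D →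
      stepLaw Ph lam (update z j v, D) * μ j (z j) = stepLaw Ph lam (z, D) * μ j v := by
  intro z D j v hj
  rw [refresh_stepLaw_apply hPh lam (update z j v) D, refresh_stepLaw_apply hPh lam z D, Finset.sum_mul, Finset.sum_mul]
  refine sum_congr rfl fun k _ => ?_
  rw [mul_assoc, mul_assoc]
  congr 1
  rw [Finset.sum_mul, Finset.sum_mul]
  refine sum_congr rfl fun D₀ hD₀ => ?_
  have hD₀' : D₀ \ ({k} : Finset (Fin d)) = D := (Finset.mem_filter.mp hD₀).2
  rw [Finset.sum_mul, Finset.sum_mul]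
  refine sum_congr rfl fun u _ => ?_
  simp_rw [hMex]
  by_cases hjk : j = k
  · subst hjk
    rw [update_idem, update_self]
    ring
  · have hjD₀ : j ∉ D₀ := fun h => hj (hD₀' ▸ Finset.mem_sdiff.mpr ⟨h, by rwa [Finset.mem_singleton]⟩)
    rw [update_comm hjk, update_of_ne (Ne.symm hjk)]
    have h := hlam (update z k u) D₀ j v hjD₀
    rw [update_of_ne hjk] at h
    calc lam (update (update z k u) j v, D₀) * μ k (z k) * μ j (z j)
        = (lam (update (update z k u) j v, D₀) * μ j (z j)) * μ k (z k) := by ring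
      _ = (lam (update z k u, D₀) * μ j v) * μ k (z k) := by rw [h]
      _ = lam (update z k u, D₀) * μ k (z k) * μ j v := by ring

/-- **FRESH-EXCHANGEABILITY AT ALL TIMES** from `δ_{(x, univ)}`. [ours] -/
theorem refresh_fresh_lawAt (hMex : ∀ k u v, M k u v = μ k v)
    {Ph : (Fin d → S) × Finset (Fin d) → (Fin d → S) × Finset (Fin d) → ℝ}
    (hPh : ∀ p q, Ph p q = ∑ k : Fin d, w k * (coordKernel M k p.1 q.1 * (if q.2 = p.2 \ {k} then (1 : ℝ) else 0)))
    (x : Fin d → S) :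
    ∀ (n : ℕ) (z : Fin d → S) (D : Finset (Fin d)) (j : Fin d) (v : S), j ∉ D →
      lawAt Ph (Pi.single (x, (univ : Finset (Fin d))) 1) n (update z j v, D) * μ j (z j)
        = lawAt Ph (Pi.single (x, (univ : Finset (Fin d))) 1) n (z, D) * μ j v := by
  intro n
  induction n with
  | zero =>
    intro z D j v hj
    have hD : D ≠ univ := fun h => hj (h ▸ mem_univ j)
    rw [lawAt_zero, Pi.single_eq_of_ne (fun h => hD (Prod.mk.inj h).2),
      Pi.single_eq_of_ne (fun h => hD (Prod.mk.inj h).2), zero_mul, zero_mul]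
  | succ n ih =>
    intro z D j v hj
    rw [lawAt_succ]
    exact refresh_fresh_step hMex hPh ih z D j v hj

omit [Fintype S] in
/-- A fresh-exchangeable function is proportional to `π̃ = ⊗μ_k` on the tag `∅` (`μ > 0`). [ours] -/
theorem fresh_empty_proportional_prod (hμ : ∀ k v, 0 < μ k v) {lam : (Fin d → S) × Finset (Fin d) → ℝ}
    (hlam : ∀ (z : Fin d → S) (D : Finset (Fin d)) (j : Fin d) (v : S), j ∉ D →
      lam (update z j v, D) * μ j (z j) = lam (z, D) * μ j v) :
    ∀ z z' : Fin d → S, lam (z, ∅) * tensorFun μ z' = lam (z', ∅) * tensorFun μ z := by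
  suffices h : ∀ (e : ℕ) (z z' : Fin d → S), (univ.filter (fun k => z k ≠ z' k)).card ≤ e →
      lam (z, ∅) * tensorFun μ z' = lam (z', ∅) * tensorFun μ z from fun z z' => h _ z z' le_rfl
  intro e
  induction e with
  | zero =>
    intro z z' he
    have hzz : z = z' := by
      funext k
      by_contra hne
      have : k ∈ univ.filter (fun k => z k ≠ z' k) := Finset.mem_filter.mpr ⟨mem_univ _, hne⟩
      exact absurd (Finset.card_pos.mpr ⟨k, this⟩) (by omega)
    rw [hzz]
  | succ e ih =>
    intro z z' he
    by_cases hzz : z = z'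
    · rw [hzz]
    · obtain ⟨k, hk⟩ : ∃ k, z k ≠ z' k := by
        by_contra hne
        push Not at hne
        exact hzz (funext hne)
      set z'' := update z k (z' k) with hz''
      have hcard : (univ.filter (fun j => z'' j ≠ z' j)).card ≤ e := by
        have hsub : univ.filter (fun j => z'' j ≠ z' j) ⊆ (univ.filter (fun j => z j ≠ z' j)).erase k := by
          intro j hj
          rw [Finset.mem_filter] at hj
          rw [Finset.mem_erase, Finset.mem_filter]
          by_cases hjk : j = k
          · subst hjk; rw [hz'', update_self] at hj; exact absurd rfl hj.2
          · rw [hz'', update_of_ne hjk] at hj; exact ⟨hjk, mem_univ _, hj.2⟩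
        have hmem : k ∈ univ.filter (fun j => z j ≠ z' j) := Finset.mem_filter.mpr ⟨mem_univ _, hk⟩
        have := Finset.card_le_card hsub
        rw [Finset.card_erase_of_mem hmem] at this
        omega
      have hIH := ih z'' z' hcard
      have hfresh : lam (z'', ∅) * μ k (z k) = lam (z, ∅) * μ k (z' k) := hlam z ∅ k (z' k) (Finset.notMem_empty k)
      have hπ : tensorFun μ z'' * μ k (z k) = tensorFun μ z * μ k (z' k) := tensorFun_update_mul μ z k (z' k)
      have hνk : μ k (z' k) ≠ 0 := (hμ _ _).ne'
      have hνzk : μ k (z k) ≠ 0 := (hμ _ _).ne'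
      have key : lam (z, ∅) * tensorFun μ z' * (μ k (z' k) * μ k (z k))
          = lam (z', ∅) * tensorFun μ z * (μ k (z' k) * μ k (z k)) := by
        calc lam (z, ∅) * tensorFun μ z' * (μ k (z' k) * μ k (z k))
            = (lam (z, ∅) * μ k (z' k)) * tensorFun μ z' * μ k (z k) := by ring
          _ = (lam (z'', ∅) * μ k (z k)) * tensorFun μ z' * μ k (z k) := by rw [hfresh]
          _ = (lam (z'', ∅) * tensorFun μ z') * (μ k (z k) * μ k (z k)) := by ring
          _ = (lam (z', ∅) * tensorFun μ z'') * (μ k (z k) * μ k (z k)) := by rw [hIH]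
          _ = lam (z', ∅) * (tensorFun μ z'' * μ k (z k)) * μ k (z k) := by ring
          _ = lam (z', ∅) * (tensorFun μ z * μ k (z' k)) * μ k (z k) := by rw [hπ]
          _ = lam (z', ∅) * tensorFun μ z * (μ k (z' k) * μ k (z k)) := by ring
      exact mul_right_cancel₀ (mul_ne_zero hνk hνzk) key

/-- **`ν̂_n(z, ∅) = (δ_{univ}Rⁿ)(∅)·π̃(z)`** for the augmented refresh chain. [ours] -/
theorem refresh_lawAt_empty_eq (hμ : ∀ k v, 0 < μ k v) (hμ1 : ∀ k, ∑ v, μ k v = 1) (hM : ∀ k, IsRowStochastic (M k))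
    (hMex : ∀ k u v, M k u v = μ k v)
    {Ph : (Fin d → S) × Finset (Fin d) → (Fin d → S) × Finset (Fin d) → ℝ}
    (hPh : ∀ p q, Ph p q = ∑ k : Fin d, w k * (coordKernel M k p.1 q.1 * (if q.2 = p.2 \ {k} then (1 : ℝ) else 0)))
    {R : Finset (Fin d) → Finset (Fin d) → ℝ}
    (hR : ∀ U V, R U V = ∑ k : Fin d, w k * (if V = U \ ({k} : Finset (Fin d)) then (1 : ℝ) else 0))
    (x : Fin d → S) (n : ℕ) (z : Fin d → S) :
    lawAt Ph (Pi.single (x, (univ : Finset (Fin d))) 1) n (z, ∅)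
      = lawAt R (Pi.single (univ : Finset (Fin d)) 1) n ∅ * tensorFun μ z := by
  have hprop := fresh_empty_proportional_prod hμ (refresh_fresh_lawAt hMex hPh x n)
  have hπ1 : ∑ z', tensorFun μ z' = 1 := sum_tensorFun_eq_one _ hμ1
  have hsum : lawAt Ph (Pi.single (x, (univ : Finset (Fin d))) 1) n (z, ∅) * ∑ z', tensorFun μ z'
      = (∑ z', lawAt Ph (Pi.single (x, (univ : Finset (Fin d))) 1) n (z', ∅)) * tensorFun μ z := by
    rw [Finset.mul_sum, Finset.sum_mul]
    exact sum_congr rfl fun z' _ => hprop z z'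
  rw [hπ1, mul_one, refresh_lawAt_snd hM hPh hR x n ∅] at hsum
  exact hsum

/-! ## §2 Minorisation, the uncovered mass, the ceiling -/

/-- **MINORISATION: `(δ_x Pⁿ)(z) ≥ (δ_{univ}Rⁿ)(∅)·π̃(z)`** for the exact-refresh product chain. [ours] -/
theorem refresh_minorization (hμ : ∀ k v, 0 < μ k v) (hμ1 : ∀ k, ∑ v, μ k v = 1) (hM : ∀ k, IsRowStochastic (M k))
    (hMex : ∀ k u v, M k u v = μ k v) (hw0 : ∀ k, 0 ≤ w k) (hw1 : ∑ k, w k = 1)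
    {R : Finset (Fin d) → Finset (Fin d) → ℝ}
    (hR : ∀ U V, R U V = ∑ k : Fin d, w k * (if V = U \ ({k} : Finset (Fin d)) then (1 : ℝ) else 0))
    (x : Fin d → S) (n : ℕ) (z : Fin d → S) :
    lawAt R (Pi.single (univ : Finset (Fin d)) 1) n ∅ * tensorFun μ z ≤ lawAt (prodKernel w M) (Pi.single x 1) n z := by
  set Ph : (Fin d → S) × Finset (Fin d) → (Fin d → S) × Finset (Fin d) → ℝ :=
    fun p q => ∑ k : Fin d, w k * (coordKernel M k p.1 q.1 * (if q.2 = p.2 \ {k} then (1 : ℝ) else 0)) with hPh_def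
  have hPh : ∀ p q, Ph p q = ∑ k : Fin d, w k * (coordKernel M k p.1 q.1 * (if q.2 = p.2 \ {k} then (1 : ℝ) else 0)) :=
    fun p q => rfl
  rw [← refresh_lawAt_fst hPh x n z, ← refresh_lawAt_empty_eq hμ hμ1 hM hMex hPh hR x n z]
  have hnn : ∀ q, 0 ≤ lawAt Ph (Pi.single (x, (univ : Finset (Fin d))) 1) n q := fun q =>
    lawAt_nonneg (refresh_aug_isRowStochastic hw0 hw1 hM hPh) (fun p => by
      by_cases h : p = (x, (univ : Finset (Fin d)))
      · subst h; rw [Pi.single_eq_same]; norm_num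
      · rw [Pi.single_eq_of_ne h]) n q
  exact Finset.single_le_sum (f := fun D => lawAt Ph (Pi.single (x, (univ : Finset (Fin d))) 1) n (z, D))
    (fun D _ => hnn (z, D)) (mem_univ ∅)

/-- **`‖δ_x Pⁿ − π̃‖_TV ≤ Σ_k (1 − w_k)ⁿ`** for the exact-refresh product chain (the uncovered mass of the site-selection
schedule, `Scaling/TouchChainCover`). [ours] -/
theorem refresh_tvDist_le (hμ : ∀ k v, 0 < μ k v) (hμ1 : ∀ k, ∑ v, μ k v = 1) (hM : ∀ k, IsRowStochastic (M k))
    (hMex : ∀ k u v, M k u v = μ k v) (hw0 : ∀ k, 0 ≤ w k) (hw1 : ∑ k, w k = 1) (x : Fin d → S) (n : ℕ) :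
    tvDist (lawAt (prodKernel w M) (Pi.single x 1) n) (tensorFun μ) ≤ ∑ k : Fin d, (1 - w k) ^ n := by
  set R : Finset (Fin d) → Finset (Fin d) → ℝ :=
    fun U V => ∑ k : Fin d, w k * (if V = U \ ({k} : Finset (Fin d)) then (1 : ℝ) else 0) with hR_def
  have hR : ∀ U V, R U V = ∑ k : Fin d, w k * (if V = U \ ({k} : Finset (Fin d)) then (1 : ℝ) else 0) := fun U V => rfl
  have hRst := touch_isRowStochastic (τ := fun k : Fin d => ({k} : Finset (Fin d))) hw0 hw1 hR
  have hmassR : ∑ V, lawAt R (Pi.single (univ : Finset (Fin d)) 1) n V = 1 := by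
    rw [sum_lawAt hRst, Finset.sum_pi_single', if_pos (mem_univ _)]
  have hsplit := Finset.sum_filter_add_sum_filter_not univ (fun V : Finset (Fin d) => V ≠ ∅)
    (fun V => lawAt R (Pi.single (univ : Finset (Fin d)) 1) n V)
  have hE : univ.filter (fun V : Finset (Fin d) => ¬V ≠ ∅) = {∅} := by
    ext V; simp only [Finset.mem_filter, Finset.mem_univ, true_and, not_not, Finset.mem_singleton]
  rw [hmassR, hE, Finset.sum_singleton] at hsplit
  have hcover := touch_lawAt_nonempty_le_sum (τ := fun k : Fin d => ({k} : Finset (Fin d))) hw0 hw1 hR univ n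
  have hrate : ∑ k ∈ (univ : Finset (Fin d)), (1 - ∑ a ∈ univ.filter (fun a : Fin d => k ∈ ({a} : Finset (Fin d))), w a) ^ n
      = ∑ k : Fin d, (1 - w k) ^ n := sum_congr rfl fun k _ => by rw [singleSite_touchRate (w := w) k]
  rw [hrate] at hcover
  have hP := prodKernel_isRowStochastic M w hw0 hw1 hM
  have htv := tvDist_le_of_pointwise_ge (fun z => (tensorFun_pos hμ z).le) (sum_tensorFun_eq_one _ hμ1)
    (by rw [sum_lawAt hP, Finset.sum_pi_single', if_pos (mem_univ _)])
    (fun z => refresh_minorization hμ hμ1 hM hMex hw0 hw1 hR x n z)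
  linarith

/-- **`d(n) ≤ Σ_k (1 − w_k)ⁿ`.** [ours] -/
theorem refresh_worstTvDist_le (hμ : ∀ k v, 0 < μ k v) (hμ1 : ∀ k, ∑ v, μ k v = 1) (hM : ∀ k, IsRowStochastic (M k))
    (hMex : ∀ k u v, M k u v = μ k v) (hw0 : ∀ k, 0 ≤ w k) (hw1 : ∑ k, w k = 1) (n : ℕ) :
    worstTvDist (prodKernel w M) (tensorFun μ) n ≤ ∑ k : Fin d, (1 - w k) ^ n := by
  have hw1' : ∀ k, w k ≤ 1 := fun k => by rw [← hw1]; exact Finset.single_le_sum (fun j _ => hw0 j) (mem_univ _)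
  exact Real.iSup_le (fun x => refresh_tvDist_le hμ hμ1 hM hMex hw0 hw1 x n)
    (sum_nonneg fun k _ => pow_nonneg (by linarith [hw1' k]) n)

/-- **`d(n) ≤ d·e^{−n·w_min}`** when every weight is `≥ w_min`. [ours] -/
theorem refresh_worstTvDist_le_exp (hμ : ∀ k v, 0 < μ k v) (hμ1 : ∀ k, ∑ v, μ k v = 1) (hM : ∀ k, IsRowStochastic (M k))
    (hMex : ∀ k u v, M k u v = μ k v) (hw0 : ∀ k, 0 ≤ w k) (hw1 : ∑ k, w k = 1) {wmin : ℝ}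
    (hwmin : ∀ k, wmin ≤ w k) (n : ℕ) :
    worstTvDist (prodKernel w M) (tensorFun μ) n ≤ (d : ℝ) * Real.exp (-(n * wmin)) := by
  have hw1' : ∀ k, w k ≤ 1 := fun k => by rw [← hw1]; exact Finset.single_le_sum (fun j _ => hw0 j) (mem_univ _)
  refine (refresh_worstTvDist_le hμ hμ1 hM hMex hw0 hw1 n).trans ?_
  rcases Nat.eq_zero_or_pos d with hd0 | hdpos
  · subst hd0; simp
  · have hwmin1 : wmin ≤ 1 := (hwmin ⟨0, hdpos⟩).trans (hw1' _)
    -- `(1−w_min)ⁿ ≤ e^{−n·w_min}` (`1 − a ≤ e^{−a}`)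
    have hpow : (1 - wmin) ^ n ≤ Real.exp (-(n * wmin)) := by
      calc (1 - wmin) ^ n ≤ (Real.exp (-wmin)) ^ n := by
            apply pow_le_pow_left₀ (by linarith)
            have := Real.add_one_le_exp (-wmin)
            linarith
        _ = Real.exp (-(n * wmin)) := by rw [← Real.exp_nat_mul]; ring_nf
    calc ∑ k : Fin d, (1 - w k) ^ n ≤ ∑ _k : Fin d, (1 - wmin) ^ n :=
          sum_le_sum fun k _ => pow_le_pow_left₀ (by linarith [hw1' k]) (by linarith [hwmin k]) n
      _ = (d : ℝ) * (1 - wmin) ^ n := by rw [sum_const, card_univ, Fintype.card_fin, nsmul_eq_mul]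
      _ ≤ (d : ℝ) * Real.exp (-(n * wmin)) := mul_le_mul_of_nonneg_left hpow (Nat.cast_nonneg _)

/-- **THE CEILING: `t_mix(ε) ≤ ⌈(log d + log(1/ε))/w_min⌉`** for the exact-refresh product chain (`d ≥ 1`,
`0 < w_min ≤ w_k`, `0 < ε`). [ours] -/
theorem refresh_mixingTime_le (hd : 1 ≤ d) (hμ : ∀ k v, 0 < μ k v) (hμ1 : ∀ k, ∑ v, μ k v = 1)
    (hM : ∀ k, IsRowStochastic (M k)) (hMex : ∀ k u v, M k u v = μ k v) (hw0 : ∀ k, 0 ≤ w k) (hw1 : ∑ k, w k = 1)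
    {wmin : ℝ} (hwmin0 : 0 < wmin) (hwmin : ∀ k, wmin ≤ w k) {ε : ℝ} (hε : 0 < ε) :
    mixingTime (prodKernel w M) (tensorFun μ) ε ≤ ⌈(Real.log d + Real.log (1 / ε)) / wmin⌉₊ := by
  set n := ⌈(Real.log d + Real.log (1 / ε)) / wmin⌉₊ with hn
  have hdpos : (0 : ℝ) < d := Nat.cast_pos.mpr (by omega)
  have hnge : (Real.log d + Real.log (1 / ε)) / wmin ≤ n := Nat.le_ceil _
  have hnw : Real.log d + Real.log (1 / ε) ≤ n * wmin := by rwa [div_le_iff₀ hwmin0] at hnge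
  refine mixingTime_le _ _ ((refresh_worstTvDist_le_exp hμ hμ1 hM hMex hw0 hw1 hwmin n).trans ?_)
  rw [← Real.exp_log hdpos, ← Real.exp_add]
  calc Real.exp (Real.log d + -(n * wmin)) ≤ Real.exp (-Real.log (1 / ε)) := Real.exp_le_exp.mpr (by linarith)
    _ = ε := by rw [Real.exp_neg, Real.exp_log (by positivity), one_div, inv_inv]

/-! ## §3 The `d·log d` law for exact redraws, both sides -/

omit [Fintype S] [DecidableEq S] in
/-- Exact redraws are reversible for their marginals. [ours] -/
theorem refresh_detailedBalance (hMex : ∀ k u v, M k u v = μ k v) : ∀ k, DetailedBalance (μ k) (M k) := by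
  intro k u v; rw [hMex, hMex]; ring

/-- **THE `d·log d` LAW FOR EXACT REDRAWS, BOTH SIDES:** `d ≥ 2`, positive probability vectors `μ_k`, exact coordinate
samplers, site-selection law `w ≥ w_min > 0`, a configuration `x` with `Σ_k μ_k(x_k) ≤ 1/4`:
**`(d − 1)·log(d/4) ≤ t_mix(1/4) ≤ ⌈(log d + log 4)/w_min⌉`**. [ours] -/
theorem refresh_mixingTime_two_sided (hd : 2 ≤ d) (hμ : ∀ k v, 0 < μ k v) (hμ1 : ∀ k, ∑ v, μ k v = 1)
    (hM : ∀ k, IsRowStochastic (M k)) (hMex : ∀ k u v, M k u v = μ k v) (hw0 : ∀ k, 0 ≤ w k) (hw1 : ∑ k, w k = 1)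
    {wmin : ℝ} (hwmin0 : 0 < wmin) (hwmin : ∀ k, wmin ≤ w k) (x : Fin d → S) (hx : ∑ k, μ k (x k) ≤ 1 / 4) :
    ((d : ℝ) - 1) * Real.log (d / 4) ≤ (mixingTime (prodKernel w M) (tensorFun μ) (1 / 4) : ℝ) ∧
      mixingTime (prodKernel w M) (tensorFun μ) (1 / 4) ≤ ⌈(Real.log d + Real.log (1 / (1 / 4 : ℝ))) / wmin⌉₊ := by
  have hceil := refresh_mixingTime_le (by omega) hμ hμ1 hM hMex hw0 hw1 hwmin0 hwmin (by norm_num : (0:ℝ) < 1 / 4)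
  refine ⟨?_, hceil⟩
  have hmix : ∃ t₀, worstTvDist (prodKernel w M) (tensorFun μ) t₀ ≤ 1 / 4 := by
    set n := ⌈(Real.log d + Real.log (1 / (1 / 4 : ℝ))) / wmin⌉₊ with hn
    have hdpos : (0 : ℝ) < d := Nat.cast_pos.mpr (by omega)
    have hnge : (Real.log d + Real.log (1 / (1 / 4 : ℝ))) / wmin ≤ n := Nat.le_ceil _
    have hnw : Real.log d + Real.log (1 / (1 / 4 : ℝ)) ≤ n * wmin := by rwa [div_le_iff₀ hwmin0] at hnge
    refine ⟨n, (refresh_worstTvDist_le_exp hμ hμ1 hM hMex hw0 hw1 hwmin n).trans ?_⟩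
    rw [← Real.exp_log hdpos, ← Real.exp_add]
    calc Real.exp (Real.log d + -(n * wmin)) ≤ Real.exp (-Real.log (1 / (1 / 4 : ℝ))) := Real.exp_le_exp.mpr (by linarith)
      _ = 1 / 4 := by rw [Real.exp_neg, Real.exp_log (by positivity), one_div, inv_inv]
  exact prodChain_mixingTime_ge_quarter hd hμ hμ1 hM (refresh_detailedBalance hMex) hw0 hw1 x hx hmix

/-- **THE `d·log d` LAW ON A LARGE ALPHABET (`|S| ≥ 4d`).** [ours] -/
theorem refresh_mixingTime_two_sided_of_card (hd : 2 ≤ d) (hS : 4 * d ≤ Fintype.card S) (hμ : ∀ k v, 0 < μ k v)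
    (hμ1 : ∀ k, ∑ v, μ k v = 1) (hM : ∀ k, IsRowStochastic (M k)) (hMex : ∀ k u v, M k u v = μ k v)
    (hw0 : ∀ k, 0 ≤ w k) (hw1 : ∑ k, w k = 1) {wmin : ℝ} (hwmin0 : 0 < wmin) (hwmin : ∀ k, wmin ≤ w k) :
    ((d : ℝ) - 1) * Real.log (d / 4) ≤ (mixingTime (prodKernel w M) (tensorFun μ) (1 / 4) : ℝ) ∧
      mixingTime (prodKernel w M) (tensorFun μ) (1 / 4) ≤ ⌈(Real.log d + Real.log (1 / (1 / 4 : ℝ))) / wmin⌉₊ := by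
  obtain ⟨x, hx⟩ := exists_rare_start_fin (μ := μ) hμ1 hS
  exact refresh_mixingTime_two_sided hd hμ hμ1 hM hMex hw0 hw1 hwmin0 hwmin x hx

end Summit.Ventures.LatticeQCDFlow.Scaling

end
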